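import Summits.Ventures.PercRepro.GenQPairChoose

/-!
# PercRepro — the singleton and pair shares at level `q` from endpoint tables (night-4, gen 3; sheet §49)

The per-element bounds of the two charging layers at a level `q`, in a form that a finite numeric table per `q`
instantiates:

* `single_share_ge_of_endpoints` — for a singleton `B₀ ∪ {x}` with `c₀ ≤ #C_x ≤ c₁`, the share is at least
  `σ₀ − (σ₀ − σ₁)·dem` as soon as `σ₀ ≤ (q/(q + 2 − c))/c` and `σ₁ ≤ (q/(q + 2 − c) − Φ_q)/c` for every
  `c ∈ [c₀, c₁]` (the demand-free and the demanding endpoints);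
* `pair_share_ge_of_endpoints` — for a pair `B₀ ∪ {x, y}` with `u₀ ≤ #(C_x ∪ C_y)` the share is at least
  `τ₀ − (τ₀ − τ₁)·dem` as soon as `τ₀ ≤ (q/(q + 3 − u))/C(u, 2)` and `τ₁ ≤ (q/(q + 3 − u) − Φ_q)/C(u, 2)` for every
  `u ∈ [u₀, q + 2]` (`m ≤ q + 2 − u`, `nb ≤ C(u, 2)`).

Both bounds are linear in `dem ∈ [0, 1]`, and a line above another at both endpoints is above it in between.
-/

namespace PercRepro.GenQ

open Finset ThmH PerFlat SixFour ThmN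

variable {α : Type*} [DecidableEq α] {M : Matroid α} [M.Finite]

/-- A linear bound from its endpoints: `A − B·d ≥ τ₀(1 − d) + τ₁·d` on `d ∈ [0, 1]` when `τ₀ ≤ A` and
`τ₁ ≤ A − B`. -/
theorem linear_ge_of_endpoints {A B τ₀ τ₁ d : ℚ} (hd0 : 0 ≤ d) (hd1 : d ≤ 1) (h0 : τ₀ ≤ A) (h1 : τ₁ ≤ A - B) :
    τ₀ - (τ₀ - τ₁) * d ≤ A - B * d := by
  nlinarith [mul_nonneg (sub_nonneg.2 hd1) (sub_nonneg.2 h0), mul_nonneg hd0 (sub_nonneg.2 h1)]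

/-- **The singleton share from an endpoint table.** -/
theorem single_share_ge_of_endpoints (hs : Simple M) {G B₀ : Finset α} {q : ℕ} (hG : G ⊆ gr M)
    (hrG : M.eRk (G : Set α) = (q : ℕ∞)) (hB : B₀ ∈ basesOf M G q) (hq : 2 ≤ q) {x : α} (hx : x ∈ G)
    (hxB : x ∉ B₀) {c₀ c₁ : ℕ} (hc₀ : c₀ ≤ (fc M x B₀).card) (hc₁ : (fc M x B₀).card ≤ c₁) {σ₀ σ₁ : ℚ}
    (h0 : ∀ c : ℕ, c₀ ≤ c → c ≤ c₁ → σ₀ ≤ ((q : ℚ) / ((q : ℚ) + 2 - c)) / c)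
    (h1 : ∀ c : ℕ, c₀ ≤ c → c ≤ c₁ → σ₁ ≤ ((q : ℚ) / ((q : ℚ) + 2 - c) - ((q : ℚ) + 2) / ((q : ℚ) + 1)) / c) :
    σ₀ - (σ₀ - σ₁) * dem M G 2 (insert x B₀) ≤ wTwo M G (insert x B₀) q / nb M G (insert x B₀) q := by
  have h := single_share_ge hs hG hrG hB hq hx hxB
  refine le_trans ?_ h
  have hd0 := dem_nonneg (M := M) G (insert x B₀) 2
  have hd1 := dem_le_one (M := M) G (insert x B₀) 2
  have hc : (0 : ℚ) < (fc M x B₀).card := by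
    have := three_le_card_fc hs ((mem_basesOf.1 hB).1.trans hG) (hG hx) (indep_of_mem_basesOf hB)
      (mem_closure_of_mem_basesOf hG hrG hB hx) hxB (Finset.card_pos.1 (by rw [(mem_basesOf.1 hB).2.2]; omega))
    exact_mod_cast (by omega : 0 < (fc M x B₀).card)
  have hA := h0 _ hc₀ hc₁
  have hB' := h1 _ hc₀ hc₁
  have : ((q : ℚ) / ((q : ℚ) + 2 - (fc M x B₀).card) - ((q : ℚ) + 2) / ((q : ℚ) + 1) * dem M G 2 (insert x B₀)) /
      (fc M x B₀).card = ((q : ℚ) / ((q : ℚ) + 2 - (fc M x B₀).card)) / (fc M x B₀).card -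
      (((q : ℚ) + 2) / ((q : ℚ) + 1) / (fc M x B₀).card) * dem M G 2 (insert x B₀) := by
    field_simp
  rw [this]
  apply linear_ge_of_endpoints hd0 hd1 hA
  rw [← sub_div]
  exact hB'

/-- **The pair share from an endpoint table.** -/
theorem pair_share_ge_of_endpoints (hs : Simple M) {G B₀ : Finset α} {q : ℕ} (hG : G ⊆ gr M)
    (hrG : M.eRk (G : Set α) = (q : ℕ∞)) (hB : B₀ ∈ basesOf M G q) (hq : 2 ≤ q) {x y : α} (hx : x ∈ G)
    (hxB : x ∉ B₀) (hy : y ∈ G) (hyB : y ∉ B₀) (hxy : x ≠ y) {u₀ : ℕ} (hu₀ : 2 ≤ u₀)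
    (hU : u₀ ≤ (fc M x B₀ ∪ fc M y B₀).card)
    {τ₀ τ₁ : ℚ} (h0 : ∀ u : ℕ, u₀ ≤ u → u ≤ q + 2 → τ₀ ≤ ((q : ℚ) / ((q : ℚ) + 3 - u)) / (u.choose 2 : ℕ))
    (h1 : ∀ u : ℕ, u₀ ≤ u → u ≤ q + 2 →
      τ₁ ≤ ((q : ℚ) / ((q : ℚ) + 3 - u) - ((q : ℚ) + 2) / ((q : ℚ) + 1)) / (u.choose 2 : ℕ)) :
    τ₀ - (τ₀ - τ₁) * dem M G 2 (insert x (insert y B₀)) ≤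
      wTwo M G (insert x (insert y B₀)) q / nb M G (insert x (insert y B₀)) q := by
  set S := insert x (insert y B₀) with hSdef
  obtain ⟨hBG, hr, hc⟩ := mem_basesOf.1 hB
  have hR : S ∈ Rq M G q := pair_mem_Rq hrG hB hx hy
  have hxS : x ∉ insert y B₀ := fun h' => by
    rcases Finset.mem_insert.1 h' with h'' | h''
    · exact hxy h''
    · exact hxB h''
  have hcardS : S.card = q + 2 := by
    rw [hSdef, Finset.card_insert_of_notMem hxS, Finset.card_insert_of_notMem hyB, hc]
  have hw0 : 0 ≤ wTwo M G S q := wTwo_nonneg_of_card_ne hs hG hq hR (by rw [hcardS]; omega)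
  have hnb1 := one_le_nb hR
  have hUq : (fc M x B₀ ∪ fc M y B₀).card ≤ q + 2 := by
    have : fc M x B₀ ∪ fc M y B₀ ⊆ S := Finset.union_subset
      ((fc_subset_insert x B₀).trans (Finset.insert_subset_insert x (Finset.subset_insert y B₀)))
      ((fc_subset_insert y B₀).trans (Finset.subset_insert x _))
    have := Finset.card_le_card this
    omega
  have hm := mTr_pair_le hG hrG hB hx hxB hy hyB hxy
  have hnb := nb_pair_le_choose hG hrG hB hx hxB hy hyB hxy
  rw [← hSdef] at hm hnb
  set u := (fc M x B₀ ∪ fc M y B₀).card with hu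
  have hchoose : (0 : ℚ) < (u.choose 2 : ℕ) := by exact_mod_cast Nat.choose_pos (by omega)
  have hd0 := dem_nonneg (M := M) G S 2
  have hd1 := dem_le_one (M := M) G S 2
  have hden : (0 : ℚ) < (q : ℚ) + 3 - u := by
    have : (u : ℚ) ≤ q + 2 := by exact_mod_cast hUq
    linarith
  have hm' : (mTr M S : ℚ) + u ≤ q + 2 := by exact_mod_cast hm
  have hwinf : (1 : ℚ) / ((q : ℚ) + 3 - u) ≤ 1 / (1 + (mTr M S : ℚ)) :=
    one_div_le_one_div_of_le (by positivity) (by linarith)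
  have hwTwo : wTwo M G S q =
      (q : ℚ) * (1 / (1 + (mTr M S : ℚ))) - ((q : ℚ) + 2) / ((q : ℚ) + 1) * dem M G 2 S := by
    unfold wTwo wInf
    push_cast
    ring
  have hwlow : (q : ℚ) / ((q : ℚ) + 3 - u) - ((q : ℚ) + 2) / ((q : ℚ) + 1) * dem M G 2 S ≤ wTwo M G S q := by
    rw [hwTwo]
    have := mul_le_mul_of_nonneg_left hwinf (Nat.cast_nonneg q)
    rw [mul_one_div] at this
    linarith
  have hnb' : (nb M G S q : ℚ) ≤ (u.choose 2 : ℕ) := by exact_mod_cast hnb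
  have hnbpos : (0 : ℚ) < nb M G S q := by exact_mod_cast (by omega : 0 < nb M G S q)
  calc τ₀ - (τ₀ - τ₁) * dem M G 2 S ≤ ((q : ℚ) / ((q : ℚ) + 3 - u)) / (u.choose 2 : ℕ) -
        (((q : ℚ) + 2) / ((q : ℚ) + 1) / (u.choose 2 : ℕ)) * dem M G 2 S := by
        apply linear_ge_of_endpoints hd0 hd1 (h0 u hU hUq)
        rw [← sub_div]
        exact h1 u hU hUq
    _ = ((q : ℚ) / ((q : ℚ) + 3 - u) - ((q : ℚ) + 2) / ((q : ℚ) + 1) * dem M G 2 S) / (u.choose 2 : ℕ) := by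
        ring
    _ ≤ wTwo M G S q / (u.choose 2 : ℕ) := div_le_div_of_nonneg_right hwlow hchoose.le
    _ ≤ wTwo M G S q / nb M G S q := div_le_div_of_nonneg_left hw0 hnbpos hnb'

/-! ## The demand indicators and the pair decomposition -/

/-- The demand of a singleton is at most `D₁ = [#K ≥ 3]` (`K = G ∖ B₀`). -/
theorem dem_insert_le_indicator {G B₀ : Finset α} {x : α} (hx : x ∈ G \ B₀) :
    dem M G 2 (insert x B₀) ≤ if (G \ B₀).card ≤ 2 then (0 : ℚ) else 1 := by
  split_ifs with hk
  · rw [dem_two_eq_zero_of_card_le_one]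
    have : G \ insert x B₀ = (G \ B₀).erase x := by
      ext e
      simp only [Finset.mem_sdiff, Finset.mem_insert, Finset.mem_erase]
      tauto
    rw [this, Finset.card_erase_of_mem hx]
    omega
  · exact dem_le_one G (insert x B₀) 2

/-- The demand of a pair is at most `D₂ = [#K ≥ 4]`. -/
theorem dem_union_pair_le_indicator {G B₀ P : Finset α} (hP : P ∈ (G \ B₀).powersetCard 2) :
    dem M G 2 (B₀ ∪ P) ≤ if (G \ B₀).card ≤ 3 then (0 : ℚ) else 1 := by
  obtain ⟨hPsub, hPc⟩ := Finset.mem_powersetCard.1 hP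
  split_ifs with hk
  · rw [dem_two_eq_zero_of_card_le_one]
    have : G \ (B₀ ∪ P) = (G \ B₀) \ P := by
      ext e
      simp only [Finset.mem_sdiff, Finset.mem_union]
      tauto
    rw [this, Finset.card_sdiff_of_subset hPsub, hPc]
    omega
  · exact dem_le_one G (B₀ ∪ P) 2

omit [M.Finite] in
/-- A pair `P ⊆ G ∖ B₀` is `{x, y}` with `B₀ ∪ P = insert y (insert x B₀)`. -/
theorem pair_decomp {G B₀ P : Finset α} (hP : P ∈ (G \ B₀).powersetCard 2) :
    ∃ x y, x ≠ y ∧ P = {x, y} ∧ x ∈ G ∧ x ∉ B₀ ∧ y ∈ G ∧ y ∉ B₀ ∧ B₀ ∪ P = insert y (insert x B₀) := by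
  obtain ⟨hPsub, hPc⟩ := Finset.mem_powersetCard.1 hP
  obtain ⟨x, y, hxy, hPxy⟩ := Finset.card_eq_two.1 hPc
  have hxP : x ∈ P := by rw [hPxy]; exact Finset.mem_insert_self x {y}
  have hyP : y ∈ P := by rw [hPxy]; exact Finset.mem_insert_of_mem (Finset.mem_singleton_self y)
  exact ⟨x, y, hxy, hPxy, (Finset.mem_sdiff.1 (hPsub hxP)).1, (Finset.mem_sdiff.1 (hPsub hxP)).2,
    (Finset.mem_sdiff.1 (hPsub hyP)).1, (Finset.mem_sdiff.1 (hPsub hyP)).2, by rw [hPxy, SixFour.union_pair_eq]⟩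

/-- **A singleton bound from a table and the demand indicator**: for `x ∈ G ∖ B₀` with `c₀ ≤ #C_x ≤ c₁`,
`σ₀ − (σ₀ − σ₁)·D₁ ≤ share` (`σ₁ ≤ σ₀`). -/
theorem single_bound_of_table (hs : Simple M) {G B₀ : Finset α} {q : ℕ} (hG : G ⊆ gr M)
    (hrG : M.eRk (G : Set α) = (q : ℕ∞)) (hB : B₀ ∈ basesOf M G q) (hq : 2 ≤ q) {x : α} (hx : x ∈ G \ B₀)
    {c₀ c₁ : ℕ} (hc₀ : c₀ ≤ (fc M x B₀).card) (hc₁ : (fc M x B₀).card ≤ c₁) {σ₀ σ₁ : ℚ} (hσ : σ₁ ≤ σ₀)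
    (h0 : ∀ c : ℕ, c₀ ≤ c → c ≤ c₁ → σ₀ ≤ ((q : ℚ) / ((q : ℚ) + 2 - c)) / c)
    (h1 : ∀ c : ℕ, c₀ ≤ c → c ≤ c₁ → σ₁ ≤ ((q : ℚ) / ((q : ℚ) + 2 - c) - ((q : ℚ) + 2) / ((q : ℚ) + 1)) / c) :
    σ₀ - (σ₀ - σ₁) * (if (G \ B₀).card ≤ 2 then (0 : ℚ) else 1) ≤
      wTwo M G (insert x B₀) q / nb M G (insert x B₀) q := by
  have h := single_share_ge_of_endpoints hs hG hrG hB hq (Finset.mem_sdiff.1 hx).1 (Finset.mem_sdiff.1 hx).2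
    hc₀ hc₁ h0 h1
  refine le_trans ?_ h
  have hd := dem_insert_le_indicator (M := M) hx
  nlinarith [mul_le_mul_of_nonneg_left hd (sub_nonneg.2 hσ)]

/-- **A pair bound from a table and the demand indicator**: for `P ∈ (G ∖ B₀).powersetCard 2` with
`u₀ ≤ #(C_x ∪ C_y)` for its two points, `τ₀ − (τ₀ − τ₁)·D₂ ≤ share` (`τ₁ ≤ τ₀`). -/
theorem pair_bound_of_table (hs : Simple M) {G B₀ : Finset α} {q : ℕ} (hG : G ⊆ gr M)
    (hrG : M.eRk (G : Set α) = (q : ℕ∞)) (hB : B₀ ∈ basesOf M G q) (hq : 2 ≤ q) {P : Finset α}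
    (hP : P ∈ (G \ B₀).powersetCard 2) {u₀ : ℕ} (hu₀ : 2 ≤ u₀)
    (hU : ∀ x ∈ P, ∀ y ∈ P, x ≠ y → u₀ ≤ (fc M x B₀ ∪ fc M y B₀).card) {τ₀ τ₁ : ℚ} (hτ : τ₁ ≤ τ₀)
    (h0 : ∀ u : ℕ, u₀ ≤ u → u ≤ q + 2 → τ₀ ≤ ((q : ℚ) / ((q : ℚ) + 3 - u)) / (u.choose 2 : ℕ))
    (h1 : ∀ u : ℕ, u₀ ≤ u → u ≤ q + 2 →
      τ₁ ≤ ((q : ℚ) / ((q : ℚ) + 3 - u) - ((q : ℚ) + 2) / ((q : ℚ) + 1)) / (u.choose 2 : ℕ)) :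
    τ₀ - (τ₀ - τ₁) * (if (G \ B₀).card ≤ 3 then (0 : ℚ) else 1) ≤ wTwo M G (B₀ ∪ P) q / nb M G (B₀ ∪ P) q := by
  obtain ⟨x, y, hxy, hPxy, hxG, hxB, hyG, hyB, hunion⟩ := pair_decomp hP
  have hd := dem_union_pair_le_indicator (M := M) hP
  have hxP : x ∈ P := by rw [hPxy]; exact Finset.mem_insert_self x {y}
  have hyP : y ∈ P := by rw [hPxy]; exact Finset.mem_insert_of_mem (Finset.mem_singleton_self y)
  have h := pair_share_ge_of_endpoints hs hG hrG hB hq hyG hyB hxG hxB hxy.symm hu₀ (hU y hyP x hxP hxy.symm)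
    h0 h1
  rw [hunion] at hd ⊢
  refine le_trans ?_ h
  nlinarith [mul_le_mul_of_nonneg_left hd (sub_nonneg.2 hτ)]

/-- **The charge of `B₀` from per-element bounds**: `Σ_x σ x + Σ_P τ P ≤ charge(B₀)` when `σ x` bounds the share of
the singleton `B₀ ∪ {x}` and `τ P` the share of the pair `B₀ ∪ P`. -/
theorem charge_ge_of_bounds_fn (hs : Simple M) {G B₀ : Finset α} {q : ℕ} (hG : G ⊆ gr M)
    (hrG : M.eRk (G : Set α) = (q : ℕ∞)) (hB : B₀ ∈ basesOf M G q) (hq : 2 ≤ q) (σ : α → ℚ) (τ : Finset α → ℚ)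
    (hσ : ∀ x ∈ G \ B₀, σ x ≤ wTwo M G (insert x B₀) q / nb M G (insert x B₀) q)
    (hτ : ∀ P ∈ (G \ B₀).powersetCard 2, τ P ≤ wTwo M G (B₀ ∪ P) q / nb M G (B₀ ∪ P) q) :
    ∑ x ∈ G \ B₀, σ x + ∑ P ∈ (G \ B₀).powersetCard 2, τ P ≤ charge M G q B₀ := by
  have h := charge_ge_singles_add_pairs hs hG hrG hB hq
  have h1 := Finset.sum_le_sum hσ
  have h2 := Finset.sum_le_sum hτ
  linarith

end PercRepro.GenQ
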